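import Literature.AlgebraicGeometry.AbelianSchemes.AbelianSchemeOverZariskiGluing
import Literature.AlgebraicGeometry.AbelianSchemes.AbelianSchemeOverIsMonHomLocal
import Literature.AlgebraicGeometry.AbelianSchemes.AbelianSchemeOverLevelBaseChange
import Literature.AlgebraicGeometry.AbelianSchemes.PolarizedAbelianSchemeWithLevelBaseChangeUnique
import HarnessLib

/-!
# Morphisms and HOMOMORPHISMS out of a glued abelian scheme

Sequel of `AbelianSchemeOverZariskiGluing` (cell hodgecm-mathlib, F-DAG hand (h7) «Zariski gluing of `S`-objects from a
cocycle», FILE 8b; consumer: the polarisation layer (P) — the glued `λ : Z → Ẑ₀` into a GIVEN dual pair of the glued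
scheme is a homomorphism defined slice by slice — and F-8 (8c)).  For a gluing datum `𝔇 : ZariskiGluingDatum S` with
glued abelian scheme `𝔇.abelianScheme` on `Z → S`:

* §1 `isMonHom_of_isBaseChangeVia_id` — a base change of group schemes ALONG `𝟙` is a homomorphism (Mathlib
  `IsMonHom`; the tree's `IsBaseChangeVia` unit/law clauses with `Over.tensorHom_left`);
* §2 `isPullback_κ` — the overlap scheme `A₂ i j` IS the fibre product `Aᵢ ×_Z Aⱼ` of the charts (lift through
  `A₂ i j = Z ×_S (Uᵢ ×_S Uⱼ)`, FILE 3a `isPullback_κ₁_χ`); `chartCover` — the open cover of `Z` by the charts `χᵢ`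
  ([GortzWedhorn2020] Prop. 3.10: «`X = ⋃ ψᵢ(Uᵢ)`»); `hom_ext_out`, and `glueOut` — MORPHISMS OUT OF `Z` from chartwise
  morphisms agreeing on the `A₂ i j` ([GortzWedhorn2020] Prop. 3.5, Mathlib `Scheme.Cover.glueMorphisms`), `χ_glueOut`;
* §3 `chartIso i : (𝔇.A i).X ≅ (𝔇.abelianScheme.baseChange (𝔇.𝒰.f i)).X` — the chart IS the base change, AS A GROUP
  SCHEME (`isMonHom_chartIso_hom`, via ★ `isBaseChangeVia_id_of_comp_eq`); **`glueHom`** — chartwise homomorphisms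
  `lamᵢ : Aᵢ → B ×_S Uᵢ` into a fixed abelian scheme `B → S`, agreeing on the overlaps, glue to `Z → B` over `S`
  (`χ_glueHom`, `chartIso_hom_pullback_map_glueHom`: its base change to `Uᵢ` is `lamᵢ`), and
  **`isMonHom_glueHom`** — it is a HOMOMORPHISM (FILE 8a `isMonHom_of_openCover`).

No named fact, no `sorry`, no instance.  HC_CM is proved only modulo the printed citations until rung 0 closes; this
file discharges none of them.

## References
* [GortzWedhorn2020] U. Görtz, T. Wedhorn, *Algebraic Geometry I*, 2nd ed. (2020), Section (3.3) Prop. 3.5 (gluing of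
  morphisms), Section (3.5) Prop. 3.10 (gluing of schemes), Section (4.8) Lemma 4.28 (points of fibre products),
  Section (4.15) (p. 116) / Def. 4.42 (p. 116) (group schemes, homomorphisms).
* [MumfordFogartyKirwan1994] D. Mumford, J. Fogarty, F. Kirwan, *Geometric Invariant Theory*, 3rd ed. (1994), Ch. 7
  §2 Def. 7.2 (p. 129) (pull-back of families).
-/

noncomputable section

universe u

open CategoryTheory CategoryTheory.Limits AlgebraicGeometry MonoidalCategory CartesianMonoidalCategory
open scoped MonObj CategoryTheory.Obj

namespace Literature.AlgebraicGeometry.AbelianSchemes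

namespace AbelianSchemeOver

/-! ### §1 A base change along `𝟙` is a homomorphism -/

/-- **A base change of group schemes along `𝟙 T` is a homomorphism**: the unit and law clauses of `IsBaseChangeVia`
along the identity are exactly `IsMonHom` (Mathlib `Over.tensorHom_left`). [cite: GortzWedhorn2020, Section (4.15) (p. 116) and Definition 4.42 (p. 116)]
[cite: MumfordFogartyKirwan1994, Ch. 7 §2 Definition 7.2 (p. 129)] -/
theorem isMonHom_of_isBaseChangeVia_id {T : Scheme.{u}} {A₁ A₂ : AbelianSchemeOver T} (e : A₂.X ⟶ A₁.X)
    (h : A₂.IsBaseChangeVia A₁ (𝟙 T) e.left) : IsMonHom e where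
  one_hom := by
    obtain ⟨-, -, hη, -⟩ := h
    ext
    rw [Over.comp_left]
    erw [hη]
    exact Category.id_comp _
  mul_hom := by
    obtain ⟨w, -, -, hμ⟩ := h
    ext
    rw [Over.comp_left, Over.comp_left, Over.tensorHom_left]
    exact hμ

namespace ZariskiGluingDatum

variable {S : Scheme.{u}} (𝔇 : ZariskiGluingDatum S)

/-! ### §2 The overlap scheme is the fibre product of the charts; the cover of `Z` by the charts -/

/-- In a cartesian square of schemes the range of `fst` is the preimage of the range of `g` (private copy of ★
`Resolution.range_eq_preimage_range_of_isPullback`, not imported to keep the import closure small).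
[cite: GortzWedhorn2020, Section (4.8) Lemma 4.28 (1)] -/
private theorem range_eq_preimage_of_isPullback {P X Y Z : Scheme.{u}} {fst : P ⟶ X} {snd : P ⟶ Y} {f : X ⟶ Z}
    {g : Y ⟶ Z} (h : IsPullback fst snd f g) : Set.range fst = f ⁻¹' Set.range g := by
  haveI : HasPullback f g := h.hasPullback
  rw [← Scheme.Pullback.range_fst f g, ← h.isoPullback_hom_fst]
  ext x
  constructor
  · rintro ⟨y, rfl⟩
    exact ⟨h.isoPullback.hom y, (Scheme.Hom.comp_apply _ _ _).symm⟩
  · rintro ⟨y, rfl⟩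
    refine ⟨h.isoPullback.inv y, ?_⟩
    rw [Scheme.Hom.comp_apply, ← Scheme.Hom.comp_apply _ h.isoPullback.hom, Iso.inv_hom_id]
    rfl

/-- **The overlap scheme `A₂ i j` is the fibre product `Aᵢ ×_Z Aⱼ` of the charts** (via `κ₁`, `κ₂`): a cone
`W → Aᵢ`, `W → Aⱼ` agreeing in `Z` lies over `Uᵢ ×_S Uⱼ` and lifts uniquely through `A₂ i j = Z ×_S (Uᵢ ×_S Uⱼ)`
(FILE 3a `isPullback_κ₁_χ`). [cite: GortzWedhorn2020, Section (4.8) Lemma 4.28] [cite: GortzWedhorn2020, Section (3.5) Proposition 3.10] -/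
theorem isPullback_κ (i j : 𝔇.𝒰.I₀) : IsPullback (𝔇.κ₁ i j) (𝔇.κ₂ i j) (𝔇.χ i) (𝔇.χ j) := by
  have wA : ∀ i, 𝔇.χ i ≫ 𝔇.Z.hom = (𝔇.A i).X.hom ≫ 𝔇.𝒰.f i := fun i => (𝔇.hχ i).w
  have w₁ : 𝔇.κ₁ i j ≫ (𝔇.A i).X.hom = (𝔇.A₂ i j).X.hom ≫ pullback.fst _ _ := (𝔇.hκ₁ i j).fst
  have w₂ : 𝔇.κ₂ i j ≫ (𝔇.A j).X.hom = (𝔇.A₂ i j).X.hom ≫ pullback.snd _ _ := (𝔇.hκ₂ i j).fst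
  refine IsPullback.of_isLimit' ⟨𝔇.hκ i j⟩ (PullbackCone.IsLimit.mk _ (fun s => ?_) (fun s => ?_) (fun s => ?_)
    (fun s m h₁ h₂ => ?_))
  · -- the lift: through `A₂ i j = Z ×_S (Uᵢ ×_S Uⱼ)`
    have hb : (s.fst ≫ (𝔇.A i).X.hom) ≫ 𝔇.𝒰.f i = (s.snd ≫ (𝔇.A j).X.hom) ≫ 𝔇.𝒰.f j := by
      rw [Category.assoc, Category.assoc, ← wA i, ← wA j, s.condition_assoc]
    have hc : (s.fst ≫ 𝔇.χ i) ≫ 𝔇.Z.hom =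
        pullback.lift (s.fst ≫ (𝔇.A i).X.hom) (s.snd ≫ (𝔇.A j).X.hom) hb ≫ pullback.fst _ _ ≫ 𝔇.𝒰.f i := by
      rw [pullback.lift_fst_assoc, Category.assoc, Category.assoc, wA i]
    exact (𝔇.isPullback_κ₁_χ i j).lift (s.fst ≫ 𝔇.χ i) _ hc
  · refine (𝔇.hχ i).hom_ext ?_ ?_
    · rw [Category.assoc, IsPullback.lift_fst]
    · rw [Category.assoc, w₁, ← Category.assoc, IsPullback.lift_snd, pullback.lift_fst]
  · refine (𝔇.hχ j).hom_ext ?_ ?_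
    · rw [Category.assoc, ← 𝔇.hκ i j, IsPullback.lift_fst, s.condition]
    · rw [Category.assoc, w₂, ← Category.assoc, IsPullback.lift_snd, pullback.lift_snd]
  · refine (𝔇.isPullback_κ₁_χ i j).hom_ext ?_ ?_
    · rw [IsPullback.lift_fst, ← Category.assoc, h₁]
    · rw [IsPullback.lift_snd]
      apply pullback.hom_ext
      · rw [Category.assoc, ← w₁, ← Category.assoc, h₁, pullback.lift_fst]
      · rw [Category.assoc, ← w₂, ← Category.assoc, h₂, pullback.lift_snd]

/-- **The open cover of the glued total space `Z` by the charts** `χᵢ : Aᵢ → Z` (open immersions as base changes of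
the `Uᵢ ↪ S`; jointly onto since the `Uᵢ` cover `S`): [GortzWedhorn2020] Prop. 3.10 «`X = ⋃ ψᵢ(Uᵢ)`».
[cite: GortzWedhorn2020, Section (3.5) Proposition 3.10] -/
def chartCover : 𝔇.Z.left.OpenCover where
  I₀ := 𝔇.𝒰.I₀
  X i := (𝔇.A i).X.left
  f := 𝔇.χ
  mem₀ := by
    rw [Scheme.presieve₀_mem_precoverage_iff]
    refine ⟨fun z => ?_, fun i => MorphismProperty.of_isPullback (𝔇.hχ i).flip inferInstance⟩
    obtain ⟨i, y, hy⟩ := 𝔇.𝒰.exists_eq (𝔇.Z.hom z)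
    have hz : z ∈ Set.range (𝔇.χ i) := by
      rw [range_eq_preimage_of_isPullback (𝔇.hχ i)]
      exact ⟨y, hy⟩
    obtain ⟨x, hx⟩ := hz
    exact ⟨i, x, hx⟩

/-- Morphisms out of `Z` agreeing on every chart are equal (Mathlib `Scheme.Cover.hom_ext` on `chartCover`).
[cite: GortzWedhorn2020, Section (3.3) Proposition 3.5] -/
theorem hom_ext_out {Y : Scheme.{u}} (u v : 𝔇.Z.left ⟶ Y) (h : ∀ i, 𝔇.χ i ≫ u = 𝔇.χ i ≫ v) : u = v :=
  Scheme.Cover.hom_ext 𝔇.chartCover u v h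

/-- **Gluing morphisms OUT of the glued scheme**: chartwise morphisms `yᵢ : Aᵢ → Y` that agree on the overlap schemes
`A₂ i j` (through `κ₁`, `κ₂`) glue to `Z → Y` ([GortzWedhorn2020] Prop. 3.5; Mathlib `Scheme.Cover.glueMorphisms` on
`chartCover`, the double overlaps being the `A₂ i j` by `isPullback_κ`). [cite: GortzWedhorn2020, Section (3.3) Proposition 3.5] -/
def glueOut {Y : Scheme.{u}} (y : ∀ i, (𝔇.A i).X.left ⟶ Y) (hy : ∀ i j, 𝔇.κ₁ i j ≫ y i = 𝔇.κ₂ i j ≫ y j) :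
    𝔇.Z.left ⟶ Y :=
  Scheme.Cover.glueMorphisms 𝔇.chartCover y fun i j => by
    show pullback.fst (𝔇.χ i) (𝔇.χ j) ≫ y i = pullback.snd (𝔇.χ i) (𝔇.χ j) ≫ y j
    rw [← cancel_epi (𝔇.isPullback_κ i j).isoPullback.hom, ← Category.assoc, ← Category.assoc,
      IsPullback.isoPullback_hom_fst, IsPullback.isoPullback_hom_snd]
    exact hy i j

/-- The glued morphism restricts to `yᵢ` on the chart `Aᵢ`. [cite: GortzWedhorn2020, Section (3.3) Proposition 3.5] -/
@[reassoc (attr := simp)]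
theorem χ_glueOut {Y : Scheme.{u}} (y : ∀ i, (𝔇.A i).X.left ⟶ Y) (hy) (i : 𝔇.𝒰.I₀) :
    𝔇.χ i ≫ 𝔇.glueOut y hy = y i :=
  Scheme.Cover.ι_glueMorphisms 𝔇.chartCover y _ i

/-! ### §3 Gluing homomorphisms out of the glued abelian scheme -/

/-- **The chart `Aᵢ` is the chosen base change `Z ×_S Uᵢ`** (as `Uᵢ`-schemes): the comparison isomorphism of the
cartesian square `hχ i` (Mathlib `IsPullback.isoPullback`). [cite: GortzWedhorn2020, Section (4.8) Lemma 4.28] -/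
def chartIso (i : 𝔇.𝒰.I₀) : (𝔇.A i).X ≅ (𝔇.abelianScheme.baseChange (𝔇.𝒰.f i)).X :=
  Over.isoMk (𝔇.hχ i).isoPullback ((𝔇.hχ i).isoPullback_hom_snd)

/-- The underlying morphism of `chartIso`. [cite: GortzWedhorn2020, Section (4.8) Lemma 4.28] -/
theorem chartIso_hom_left (i : 𝔇.𝒰.I₀) : (𝔇.chartIso i).hom.left = (𝔇.hχ i).isoPullback.hom := rfl

/-- **`chartIso` is an isomorphism of GROUP schemes**: both `Aᵢ` (FILE 3b `isBaseChangeVia_abelianScheme`) and `Z ×_S Uᵢ`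
(★ `baseChange_isBaseChangeVia`) are base changes of the glued abelian scheme along `Uᵢ → S`, hence related along `𝟙`
(★ `isBaseChangeVia_id_of_comp_eq`). [cite: MumfordFogartyKirwan1994, Ch. 7 §2 Definition 7.2 (p. 129)]
[cite: GortzWedhorn2020, Section (4.15) (p. 116) and Definition 4.42 (p. 116)] -/
theorem isMonHom_chartIso_hom (i : 𝔇.𝒰.I₀) : IsMonHom (𝔇.chartIso i).hom :=
  isMonHom_of_isBaseChangeVia_id _ (isBaseChangeVia_id_of_comp_eq (𝔇.abelianScheme.baseChange_isBaseChangeVia (𝔇.𝒰.f i))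
    (𝔇.isBaseChangeVia_abelianScheme i) (𝔇.hχ i).isoPullback.hom ((𝔇.hχ i).isoPullback_hom_fst)
    ((𝔇.hχ i).isoPullback_hom_snd))

variable (B : AbelianSchemeOver S) (lam : ∀ i, (𝔇.A i).X ⟶ (B.baseChange (𝔇.𝒰.f i)).X)
  (hlam : ∀ i j, 𝔇.κ₁ i j ≫ (lam i).left ≫ pullback.fst B.X.hom (𝔇.𝒰.f i) =
    𝔇.κ₂ i j ≫ (lam j).left ≫ pullback.fst B.X.hom (𝔇.𝒰.f j))

include hlam

/-- Reassociated overlap compatibility of the chartwise homomorphisms. [cite: GortzWedhorn2020, Section (3.3) Proposition 3.5] -/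
theorem glueHom_aux (i j : 𝔇.𝒰.I₀) :
    𝔇.κ₁ i j ≫ ((lam i).left ≫ pullback.fst B.X.hom (𝔇.𝒰.f i)) =
      𝔇.κ₂ i j ≫ ((lam j).left ≫ pullback.fst B.X.hom (𝔇.𝒰.f j)) := by
  rw [← Category.assoc, ← Category.assoc]
  exact hlam i j

/-- The glued morphism `Z → B` lies over `S` (checked on the charts). [cite: GortzWedhorn2020, Section (3.3) Proposition 3.5] -/
theorem glueOut_lam_comp_hom :
    𝔇.glueOut (fun i => (lam i).left ≫ pullback.fst B.X.hom (𝔇.𝒰.f i)) (𝔇.glueHom_aux B lam hlam) ≫ B.X.hom =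
      𝔇.Z.hom := by
  refine 𝔇.hom_ext_out _ _ fun i => ?_
  have h1 : (lam i).left ≫ pullback.snd B.X.hom (𝔇.𝒰.f i) = (𝔇.A i).X.hom := Over.w (lam i)
  rw [χ_glueOut_assoc, Category.assoc]
  erw [pullback.condition, ← Category.assoc, h1]
  exact (𝔇.hχ i).w.symm

/-- **Gluing chartwise homomorphisms**: `S`-morphisms `lamᵢ : Aᵢ → B ×_S Uᵢ` (over `Uᵢ`) into a fixed abelian scheme
`B → S`, agreeing on the overlap schemes after projection to `B`, glue to an `S`-morphism `Z → B`
([GortzWedhorn2020] Prop. 3.5). [cite: GortzWedhorn2020, Section (3.3) Proposition 3.5] -/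
def glueHom : 𝔇.abelianScheme.X ⟶ B.X :=
  Over.homMk (𝔇.glueOut (fun i => (lam i).left ≫ pullback.fst B.X.hom (𝔇.𝒰.f i)) (𝔇.glueHom_aux B lam hlam))
    (𝔇.glueOut_lam_comp_hom B lam hlam)

/-- The underlying morphism of `glueHom` is `glueOut` of the `lamᵢ ≫ pr_B`. [cite: GortzWedhorn2020, Section (3.3) Proposition 3.5] -/
theorem glueHom_left :
    (𝔇.glueHom B lam hlam).left =
      𝔇.glueOut (fun i => (lam i).left ≫ pullback.fst B.X.hom (𝔇.𝒰.f i)) (𝔇.glueHom_aux B lam hlam) :=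
  rfl

/-- On the chart `Aᵢ`, `glueHom` is `lamᵢ` followed by the projection to `B`. [cite: GortzWedhorn2020, Section (3.3) Proposition 3.5] -/
theorem χ_glueHom (i : 𝔇.𝒰.I₀) :
    𝔇.χ i ≫ (𝔇.glueHom B lam hlam).left = (lam i).left ≫ pullback.fst B.X.hom (𝔇.𝒰.f i) := by
  rw [glueHom_left, χ_glueOut]

/-- **The base change of `glueHom` to `Uᵢ` IS `lamᵢ`** (through `chartIso i`): «`(G ×_S S')_{S'}(T) = G_S(T)`».
[cite: GortzWedhorn2020, Section (4.15) (p. 116)] -/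
theorem chartIso_hom_pullback_map_glueHom (i : 𝔇.𝒰.I₀) :
    (𝔇.chartIso i).hom ≫ (Over.pullback (𝔇.𝒰.f i)).map (𝔇.glueHom B lam hlam) = lam i := by
  ext
  rw [Over.comp_left, chartIso_hom_left]
  simp only [Over.pullback_map_left]
  apply pullback.hom_ext
  · erw [Category.assoc, pullback.lift_fst, ← Category.assoc, (𝔇.hχ i).isoPullback_hom_fst, χ_glueHom]
    rfl
  · erw [Category.assoc, pullback.lift_snd]
    try simp only [Category.comp_id]
    erw [(𝔇.hχ i).isoPullback_hom_snd]
    exact (Over.w (lam i)).symm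

/-- **Chartwise homomorphisms glue to a HOMOMORPHISM**: if every `lamᵢ` is a homomorphism of `Uᵢ`-group schemes then
`glueHom` is a homomorphism of `S`-group schemes — `IsMonHom` is Zariski-local on the base (FILE 8a
`isMonHom_of_openCover`) and the base change of `glueHom` to `Uᵢ` is `chartIso⁻¹ ≫ lamᵢ`.
[cite: GortzWedhorn2020, Section (4.15) (p. 116) and Definition 4.42 (p. 116)] -/
theorem isMonHom_glueHom (h : ∀ i, IsMonHom (lam i)) : IsMonHom (𝔇.glueHom B lam hlam) := by
  refine 𝔇.abelianScheme.isMonHom_of_openCover B 𝔇.𝒰 _ fun i => ?_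
  haveI := 𝔇.isMonHom_chartIso_hom i
  haveI : IsMonHom (𝔇.chartIso i).inv := inferInstance
  haveI := h i
  have hcomp : IsMonHom ((𝔇.chartIso i).inv ≫ lam i) := inferInstance
  have e : (Over.pullback (𝔇.𝒰.f i)).map (𝔇.glueHom B lam hlam) = (𝔇.chartIso i).inv ≫ lam i :=
    ((Iso.eq_inv_comp _).mpr (𝔇.chartIso_hom_pullback_map_glueHom B lam hlam i))
  exact e ▸ hcomp

end ZariskiGluingDatum

end AbelianSchemeOver

end Literature.AlgebraicGeometry.AbelianSchemes

end
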